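import Summits.CriticalPhenomena.Ising3DConformalLimit.Theses.BallSpecification
import Summits.CriticalPhenomena.Ising3DConformalLimit.Theses.MarkovRigidity
import Summits.CriticalPhenomena.Ising3DConformalLimit.Theorems.BallSpecificationBallSpecifiedFieldLimitProperGermKernels
import Summits.CriticalPhenomena.Ising3DConformalLimit.Theorems.BallSpecificationBallSpecifiedFieldLimitFieldLimitOfEuclidean
import Summits.CriticalPhenomena.Ising3DConformalLimit.Theorems.BallSpecificationBallSpecifiedFieldLimitSplitAtSpheres
import Summits.CriticalPhenomena.Ising3DConformalLimit.Theorems.BallSpecificationBallSpecifiedFieldLimitOneSidedGermOfMI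
import Literature.MathematicalPhysics.QuantumLattice.BallSpecificationProperKernels
import Literature.MathematicalPhysics.QuantumLattice.GermMarkov
import Literature.Probability.LatticeModels.ScalingLimit3D

/-!
# Crux `BallSpecification.BallSpecifiedFieldLimit` (stmt-CriticalPhenomena-11247) — skeleton `Lines/birth.lean`, RESHAPED (lead c3)

Skeleton registrar `planner-skel-stmt-CriticalPhenomena-11247-0` (2026-08-17); leads
`prover-line-stmt-CriticalPhenomena-11247-c2-0` (cycles 1–2: stubs S3, S2a, S2c, S2d LANDED —
`…Theorems.stub_properGermKernels` p146798, `…stub_thickShellMarkov` p152556,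
`…stub_germOfShellMarkov` p152342, `…stub_shellOfGermMarkov` p151650) and
`prover-line-stmt-CriticalPhenomena-11247-c3-0` (cycle 3, THIS RESHAPING).

The crux (`∃ ρ Δ S L μ γ, C1 ∧ … ∧ C17`): the full `δ → 0⁺` scaling limit of the critical 3-D Ising
spin field CARRIED BY A LAW `μ` on `𝓢'(ℝ³)` (C1–C12) which is SPECIFIED ON BALLS by proper,
exterior-measurable, germ-Markov kernels with the DLR equations (C13–C17).

## Cycle 3 reshaping (lead c3): the crux's open mathematics = two EXISTING registered statements

Cycle 2 left two open stubs: S1 `stub_fieldLimit` (C1–C12, the field scaling limit: OPEN) and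
S2b `stub_shellMarkovInheritance` (thick-shell Markov survives the limit: OPEN). This cycle
replaces both by stubs that are registered statements ELSEWHERE in the tree, plus provable glue:

* `stub_euclideanLimit` := `Literature.Probability.LatticeModels.CritIsing3DEuclideanLimit` VERBATIM —
  the registered open conjecture crit-ising.S03 (pointwise Euclidean-invariant, scale-covariant,
  non-degenerate scaling limit of `criticalCorr 3`; Duminil-Copin ICM 2022 §8.4). OPEN; no worker.
* GLUE `stub_fieldLimitOfEuclidean` — **LANDED p155926** (`Theorems/BallSpecificationBallSpecifiedFieldLimitFieldLimitOfEuclidean.lean`,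
  lead c3; no longer a stub, imported): S03 ⇒ the old S1 (C1–C12) together with
  `IsProbabilityMeasure μ`, all moments, exponential moments and a mesh-free kernel bound on `S₂` —
  by NORMALISING the S03 witness off `NonCoincident`, REALISING the field through the landed
  MarkovRigidity machinery (`MarkovRigidityFieldRealisation.exists_limitLaw`: Minlos measure of the
  moment series, limit in law of the fields smeared from the critical DLR state `ν`, ANY boxes with
  `δ·L(δ) → ∞`), TRANSFERRING the limit in law to the finite-volume `+` boxes of C9
  (`norm_genFunctional_isingFieldLaw_sub_spinFieldLaw_le` + `tendsto_plusBoundaryMagnetization_of_center`,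
  with `L(δ)` CHOSEN so large that `ρ(δ)·⟨σ₀⟩⁺_{box ⌊L/2⌋;β_c} → 0`, possible because
  `m*(β_c) = 0`, `spontaneousMagnetization_criticalBeta_eq_zero_holds`), and upgrading translation to
  EUCLIDEAN invariance of the law (`map_act_eq_self` with the Euclidean motions). Hence
  S1 ⇔ S03: the field carrier costs nothing beyond the pointwise conjecture.
* `stub_markovInheritanceMI` := the signature of item stmt-CriticalPhenomena-11236
  (`Theses.MarkovRigidity.MarkovInheritance`, crux rank 2 of route MarkovRigidity) VERBATIM — McKean's
  two-sided germ-Markov property of every law `μ` carrying a pointwise critical limit as moment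
  densities. OPEN (Ising-specific); no worker — it has its own leads.
* B1 `stub_splitAtSpheres` — **LANDED p156027** (`Theorems/BallSpecificationBallSpecifiedFieldLimitSplitAtSpheres.lean`, wave-3
  worker; no longer a stub, imported): a law on `𝓢'(ℝ³)` with square-integrable
  evaluations and a two-point DENSITY dominated by `C·max(1, ‖x₀−x₁‖^{-a})`, `a < 3`, splits every test
  function at every sphere modulo null sets (`L²` cutoff argument: the sphere is Lebesgue-null).
* B2 `stub_oneSidedGermOfMI` — **LANDED p156110** (`Theorems/BallSpecificationBallSpecifiedFieldLimitOneSidedGermOfMI.lean`,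
  wave-3 worker; no longer a stub, imported): splitting at spheres + the MI conclusion on
  all balls ⇒ the ONE-SIDED a.e. germ-Markov property (`germEvents c r`-measurable versions of
  `μ[A | extEvents (closedBall c r)ᶜ]` for interior `A`) — the hypothesis of the landed S3.

Composition: S03 → MI → crux (GLUE, B1, B2 and S3 landed, imported): the crux is now EXACTLY
`CritIsing3DEuclideanLimit ∧ MarkovInheritance(11236)` modulo landed theorems — it carries no open
mathematics of its own; both remaining stubs are registered open statements owned elsewhere.

Disproof used: none (no `Disproof.lean` / `Negative/` for this crux, `ledger crux ls`, 2026-08-17).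
-/

noncomputable section

namespace Summit.CriticalPhenomena.Ising3DConformalLimit.Cruxes.BallSpecifiedFieldLimit.Birth

open MeasureTheory Filter

/-- Registered stub `stub_euclideanLimit` — **S03, the registered open conjecture
`Literature.Probability.LatticeModels.CritIsing3DEuclideanLimit` verbatim** (crit-ising.S03: the
rescaled critical Ising correlators on `ℤ³` have a non-degenerate, Euclidean-invariant,
scale-covariant pointwise scaling limit; Duminil-Copin ICM 2022 §8.4: open). By the landed projection
the crux implies it, and by `stub_fieldLimitOfEuclidean` it gives back conjuncts C1–C12. -/
theorem stub_euclideanLimit :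
    Literature.Probability.LatticeModels.CritIsing3DEuclideanLimit := by
  sorry

/-- Registered stub `stub_markovInheritanceMI` — **the signature of item stmt-CriticalPhenomena-11236
(`Summit.CriticalPhenomena.Ising3DConformalLimit.Theses.MarkovRigidity.MarkovInheritance`, crux rank 2
of route MarkovRigidity) VERBATIM**: every probability law `μ` on `𝓢'(ℝ³)` with all moments,
exponential moments and moment densities `S` — `S` a normalised, non-degenerate, translation-invariant,
`Δ`-scale-covariant pointwise scaling limit of `criticalCorr 3` — is germ-Markov in McKean's (two-sided)
sense across the boundary of every open ball and open half-space. OPEN (Ising-specific: conditional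
independence is not closed under limits in law). -/
theorem stub_markovInheritanceMI :
    ∀ (ρ : ℝ → ℝ) (Δ : ℝ) (S : Literature.Probability.LatticeModels.CorrFamily 3) (μ : MeasureTheory.Measure (Literature.MathematicalPhysics.QuantumLattice.FieldConfig (EuclideanSpace ℝ (Fin 3)))), (∀ δ ∈ Set.Ioc (0:ℝ) 1, 0 < ρ δ) → Literature.Probability.LatticeModels.HasPointwiseScalingLimit (Literature.Probability.LatticeModels.criticalCorr 3) ρ S → (∀ n z, z ∉ Literature.Probability.LatticeModels.NonCoincident 3 n → S n z = 0) → Literature.Probability.LatticeModels.IsNondegenerateTwoPoint S → Literature.Probability.LatticeModels.IsTranslationInvariant S → Literature.Probability.LatticeModels.IsScaleCovariant Δ S → MeasureTheory.IsProbabilityMeasure μ → Literature.MathematicalPhysics.QuantumLattice.HasAllMoments μ → (∀ f : SchwartzMap (EuclideanSpace ℝ (Fin 3)) ℝ, MeasureTheory.Integrable (fun ω : Literature.MathematicalPhysics.QuantumLattice.FieldConfig (EuclideanSpace ℝ (Fin 3)) => Real.exp (ω f)) μ) → (∀ (n : ℕ) (f : Fin n → SchwartzMap (EuclideanSpace ℝ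 (Fin 3)) ℝ), Literature.MathematicalPhysics.QuantumLattice.moment μ n f = ∫ x : Fin n → EuclideanSpace ℝ (Fin 3), S n x * ∏ i, f i (x i)) → ∀ (sig : Set (EuclideanSpace ℝ (Fin 3)) → MeasurableSpace (Literature.MathematicalPhysics.QuantumLattice.FieldConfig (EuclideanSpace ℝ (Fin 3)))), (sig = fun A => ⨆ (f : SchwartzMap (EuclideanSpace ℝ (Fin 3)) ℝ) (_ : tsupport ⇑f ⊆ A), MeasurableSpace.comap (fun ω : Literature.MathematicalPhysics.QuantumLattice.FieldConfig (EuclideanSpace ℝ (Fin 3)) => ω f) (borel ℝ)) → ∀ (U : Set (EuclideanSpace ℝ (Fin 3))), ((∃ (c : EuclideanSpace ℝ (Fin 3)) (r : ℝ), U = Metric.ball c r) ∨ (∃ (v : EuclideanSpace ℝ (Fin 3)) (a : ℝ), v ≠ 0 ∧ U = {x | a < inner ℝ x v})) → ∀ (F : Literature.MathematicalPhysics.QuantumLattice.FieldConfig (EuclideanSpace ℝ (Fin 3)) → ℝ), @Measurable _ _ (⨅ (ε : ℝ) (_ : 0 < ε), sig (Metric.thickening ε U)) _ F → (∃ C : ℝ,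 ∀ ω, |F ω| ≤ C) → MeasureTheory.condExp ((⨅ (ε : ℝ) (_ : 0 < ε), sig (Metric.thickening ε Uᶜ)) ⊔ ⨅ (ε : ℝ) (_ : 0 < ε), sig (Metric.thickening ε (frontier U))) μ F =ᵐ[μ] MeasureTheory.condExp (⨅ (ε : ℝ) (_ : 0 < ε), sig (Metric.thickening ε (frontier U))) μ F := by
  sorry

/-! ### The stub statements BY NAME — the hypotheses of `BallSpecifiedFieldLimit_of`

`#h21_check_skeleton` admits a hypothesis of the composing theorem only if its head constant is a
registered obligation or is NAMED like a declared stub; each `stub_X : <signature> := by sorry` above is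
mirrored by `abbrev __Registered.stub_X : Prop := <the same signature, verbatim>`. -/
namespace __Registered

/-- Alias of the statement of the registered stub `stub_euclideanLimit` (S03), keyed by its name. -/
abbrev stub_euclideanLimit : Prop :=
    Literature.Probability.LatticeModels.CritIsing3DEuclideanLimit

/-- Alias of the statement of the registered stub `stub_markovInheritanceMI` (= item 11236), keyed by its name. -/
abbrev stub_markovInheritanceMI : Prop :=
    ∀ (ρ : ℝ → ℝ) (Δ : ℝ) (S : Literature.Probability.LatticeModels.CorrFamily 3) (μ : MeasureTheory.Measure (Literature.MathematicalPhysics.QuantumLattice.FieldConfig (EuclideanSpace ℝ (Fin 3)))), (∀ δ ∈ Set.Ioc (0:ℝ) 1, 0 < ρ δ) → Literature.Probability.LatticeModels.HasPointwiseScalingLimit (Literature.Probability.LatticeModels.criticalCorr 3) ρ S → (∀ n z, z ∉ Literature.Probability.LatticeModels.NonCoincident 3 n → S n z = 0) → Literature.Probability.LatticeModels.IsNondegenerateTwoPoint S → Literature.Probability.LatticeModels.IsTranslationInvariant S → Literature.Probability.LatticeModels.IsScaleCovariant Δ S → MeasureTheory.IsProbabilityMeasure μ → Literature.MathematicalPhysics.QuantumLattice.HasAllMoments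 μ → (∀ f : SchwartzMap (EuclideanSpace ℝ (Fin 3)) ℝ, MeasureTheory.Integrable (fun ω : Literature.MathematicalPhysics.QuantumLattice.FieldConfig (EuclideanSpace ℝ (Fin 3)) => Real.exp (ω f)) μ) → (∀ (n : ℕ) (f : Fin n → SchwartzMap (EuclideanSpace ℝ (Fin 3)) ℝ), Literature.MathematicalPhysics.QuantumLattice.moment μ n f = ∫ x : Fin n → EuclideanSpace ℝ (Fin 3), S n x * ∏ i, f i (x i)) → ∀ (sig : Set (EuclideanSpace ℝ (Fin 3)) → MeasurableSpace (Literature.MathematicalPhysics.QuantumLattice.FieldConfig (EuclideanSpace ℝ (Fin 3)))), (sig = fun A => ⨆ (f : SchwartzMap (EuclideanSpace ℝ (Fin 3)) ℝ) (_ : tsupport ⇑f ⊆ A), MeasurableSpace.comap (fun ω : Literature.MathematicalPhysics.QuantumLattice.FieldConfig (EuclideanSpace ℝ (Fin 3)) => ω f) (borel ℝ)) → ∀ (U : Set (EuclideanSpace ℝ (Fin 3))), ((∃ (c : EuclideanSpace ℝ (Fin 3)) (r : ℝ), U = Metric.ball c r) ∨ (∃ (v : EuclideanSpace ℝ (Fin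 3)) (a : ℝ), v ≠ 0 ∧ U = {x | a < inner ℝ x v})) → ∀ (F : Literature.MathematicalPhysics.QuantumLattice.FieldConfig (EuclideanSpace ℝ (Fin 3)) → ℝ), @Measurable _ _ (⨅ (ε : ℝ) (_ : 0 < ε), sig (Metric.thickening ε U)) _ F → (∃ C : ℝ, ∀ ω, |F ω| ≤ C) → MeasureTheory.condExp ((⨅ (ε : ℝ) (_ : 0 < ε), sig (Metric.thickening ε Uᶜ)) ⊔ ⨅ (ε : ℝ) (_ : 0 < ε), sig (Metric.thickening ε (frontier U))) μ F =ᵐ[μ] MeasureTheory.condExp (⨅ (ε : ℝ) (_ : 0 < ε), sig (Metric.thickening ε (frontier U))) μ F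

end __Registered

/-! ### Elementary glue used by the composition -/

/-- For two points, non-coincidence is `x 0 ≠ x 1`. [folklore] -/
theorem mem_nonCoincident_two {x : Fin 2 → EuclideanSpace ℝ (Fin 3)} (hx : x 0 ≠ x 1) :
    x ∈ Literature.Probability.LatticeModels.NonCoincident 3 2 := by
  rw [Literature.Probability.LatticeModels.mem_nonCoincident]
  intro i j hij
  fin_cases i <;> fin_cases j
  · rfl
  · exact absurd hij hx
  · exact absurd hij.symm hx
  · rfl

/-- The two-point function from the moment densities: `E_μ[ω(f) ω(g)] = ∫ S₂(x) f(x₀) g(x₁) dx`.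
[folklore] -/
theorem integral_eval_mul_eval_of_hasMomentDensity
    {μ : MeasureTheory.Measure (Literature.MathematicalPhysics.QuantumLattice.FieldConfig (EuclideanSpace ℝ (Fin 3)))}
    {S : Literature.Probability.LatticeModels.CorrFamily 3}
    (h : Literature.MathematicalPhysics.QuantumLattice.HasMomentDensity μ S)
    (f g : SchwartzMap (EuclideanSpace ℝ (Fin 3)) ℝ) :
    ∫ ω, ω f * ω g ∂μ = ∫ x : Fin 2 → EuclideanSpace ℝ (Fin 3), S 2 x * (f (x 0) * g (x 1)) := by
  have h2 := h 2 ![f, g]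
  simp only [Literature.MathematicalPhysics.QuantumLattice.moment, Fin.prod_univ_two,
    Matrix.cons_val_zero, Matrix.cons_val_one] at h2
  exact h2

/-- **Composition `BallSpecifiedFieldLimit_of : S03 → MI → BallSpecifiedFieldLimit`**
(kernel-checked, no `sorry`; hypotheses = the two OPEN stub statements by name — the registered
conjecture crit-ising.S03 and the signature of item stmt-CriticalPhenomena-11236; GLUE, B1, B2 and the
kernel node S3 are the LANDED theorems `…Theorems.stub_fieldLimitOfEuclidean` p155926,
`…Theorems.stub_splitAtSpheres` p156027, `…Theorems.stub_oneSidedGermOfMI` p156110,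
`…Theorems.stub_properGermKernels` p146798): GLUE turns the S03 witness into the
field limit `(ρ, Δ, S, L, μ)` with C1–C12 and the moment data; MI (item 11236) applied to
`(ρ, Δ, S, μ)` gives McKean's germ-Markov property of `μ` on every ball; B1 gives the splitting of test
functions at spheres from the two-point data; B2 turns both into the one-sided a.e. germ-Markov
property; S3 manufactures the kernels `γ` with C13–C17; reassemble the seventeen conjuncts. -/
theorem BallSpecifiedFieldLimit_of :
    __Registered.stub_euclideanLimit →
    __Registered.stub_markovInheritanceMI →
    Summit.CriticalPhenomena.Ising3DConformalLimit.Theses.BallSpecification.BallSpecifiedFieldLimit := by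
  intro hE hMI
  dsimp only [__Registered.stub_euclideanLimit, __Registered.stub_markovInheritanceMI] at hE hMI
  -- GLUE (LANDED, p155926): the S03 witness gives the field limit with its moment data
  obtain ⟨ρ, Δ, S, L, μ, ⟨hρ, hΔ, hlim, hnorm, hnd, heuc, hsc, hL, hlaw, hmom, heucl, hscl⟩,
    hprob, hallm, hexp, hSm, hK⟩ :=
    Summit.CriticalPhenomena.Ising3DConformalLimit.Theorems.stub_fieldLimitOfEuclidean hE
  haveI := hprob
  -- MI (item 11236) for this `μ`, on balls
  have hMIμ := hMI ρ Δ S μ hρ hlim hnorm hnd heuc.1 hsc hprob hallm hexp (fun n f => hmom n f)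
    (fun A => ⨆ (f : SchwartzMap (EuclideanSpace ℝ (Fin 3)) ℝ) (_ : tsupport ⇑f ⊆ A),
      MeasurableSpace.comap (fun ω : Literature.MathematicalPhysics.QuantumLattice.FieldConfig (EuclideanSpace ℝ (Fin 3)) => ω f) (borel ℝ)) rfl
  have hballs : ∀ (c : EuclideanSpace ℝ (Fin 3)) (r : ℝ), 0 < r → ∀ F : Literature.MathematicalPhysics.QuantumLattice.FieldConfig (EuclideanSpace ℝ (Fin 3)) → ℝ,
        Measurable[⨅ (ε : ℝ) (_ : 0 < ε), Literature.MathematicalPhysics.QuantumLattice.extEvents (Metric.thickening ε (Metric.ball c r))] F →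
        (∃ C : ℝ, ∀ ω, |F ω| ≤ C) →
        MeasureTheory.condExp ((⨅ (ε : ℝ) (_ : 0 < ε), Literature.MathematicalPhysics.QuantumLattice.extEvents (Metric.thickening ε (Metric.ball c r)ᶜ)) ⊔
            ⨅ (ε : ℝ) (_ : 0 < ε), Literature.MathematicalPhysics.QuantumLattice.extEvents (Metric.thickening ε (frontier (Metric.ball c r)))) μ F
          =ᵐ[μ] MeasureTheory.condExp (⨅ (ε : ℝ) (_ : 0 < ε), Literature.MathematicalPhysics.QuantumLattice.extEvents (Metric.thickening ε (frontier (Metric.ball c r)))) μ F :=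
    fun c r _ F hF hbd => hMIμ (Metric.ball c r) (Or.inl ⟨c, r, rfl⟩) F hF hbd
  -- the two-point data for B1
  obtain ⟨C, a, ha0, ha3, hCa⟩ := hK
  -- B1 (LANDED, p156027): test functions split at every sphere modulo `μ`
  have hsplit := Summit.CriticalPhenomena.Ising3DConformalLimit.Theorems.stub_splitAtSpheres μ hprob
    (fun f => by exact_mod_cast hallm 2 f)
    ⟨S 2, C, a, hSm 2, ha0, ha3, fun x hx => hCa x (mem_nonCoincident_two hx),
      integral_eval_mul_eval_of_hasMomentDensity hmom⟩
  -- B2 (LANDED, p156110): the one-sided a.e. germ-Markov property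
  have hmarkov := Summit.CriticalPhenomena.Ising3DConformalLimit.Theorems.stub_oneSidedGermOfMI μ hprob
    hsplit hballs
  -- S3 (LANDED, p146798): kernel version with C13–C17
  obtain ⟨γ, h13, h14, h15, h16, h17⟩ :=
    Summit.CriticalPhenomena.Ising3DConformalLimit.Theorems.stub_properGermKernels μ hprob hmarkov
  exact ⟨ρ, Δ, S, L, μ, γ, hρ, hΔ, hlim, hnorm, hnd, heuc, hsc, hL, hlaw, hmom, heucl, hscl,
    h13, h14, h15, h16, h17⟩


/-- **The crux from the two EXISTING open statements, by their tree names**: the registered conjecture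
crit-ising.S03 `Literature.Probability.LatticeModels.CritIsing3DEuclideanLimit` and the statement of item
stmt-CriticalPhenomena-11236 `Summit.CriticalPhenomena.Ising3DConformalLimit.Theses.MarkovRigidity.MarkovInheritance`
(crux rank 2 of route MarkovRigidity) together imply `BallSpecifiedFieldLimit` (everything else is
landed: GLUE p155926, B1 p156027, B2 p156110, S3 p146798). [folklore] -/
theorem ballSpecifiedFieldLimit_of_euclideanLimit_of_markovInheritance
    (hE : Literature.Probability.LatticeModels.CritIsing3DEuclideanLimit)
    (hMI : Summit.CriticalPhenomena.Ising3DConformalLimit.Theses.MarkovRigidity.MarkovInheritance) :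
    Summit.CriticalPhenomena.Ising3DConformalLimit.Theses.BallSpecification.BallSpecifiedFieldLimit :=
  BallSpecifiedFieldLimit_of hE hMI

/-- **The registered stubs discharge the hypotheses of `BallSpecifiedFieldLimit_of` verbatim**
(kernel-checked `example`, deliberately NOT a named declaration: it depends on the stubs' `sorry`s until
they land). -/
example :
    Summit.CriticalPhenomena.Ising3DConformalLimit.Theses.BallSpecification.BallSpecifiedFieldLimit :=
  BallSpecifiedFieldLimit_of stub_euclideanLimit stub_markovInheritanceMI

/-- **The crux contains the registered open conjecture crit-ising.S03** (projection; with
`stub_fieldLimitOfEuclidean` this makes conjuncts C1–C12 of the crux EQUIVALENT to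
`CritIsing3DEuclideanLimit`). [folklore] -/
theorem critIsing3DEuclideanLimit_of_ballSpecifiedFieldLimit
    (h : Summit.CriticalPhenomena.Ising3DConformalLimit.Theses.BallSpecification.BallSpecifiedFieldLimit) :
    Literature.Probability.LatticeModels.CritIsing3DEuclideanLimit := by
  obtain ⟨ρ, Δ, S, L, μ, γ, hρ, hΔ, hlim, -, hnd, hE, hsc, -⟩ := h
  exact ⟨ρ, Δ, S, hρ, hΔ, hlim, hnd, hE, hsc⟩

end Summit.CriticalPhenomena.Ising3DConformalLimit.Cruxes.BallSpecifiedFieldLimit.Birth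

end
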